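import Literature.MathematicalPhysics.QuantumFieldTheory.Balaban1983to89.B10Eq71TorusOverlap
import Literature.MathematicalPhysics.QuantumFieldTheory.Balaban1983to89.B10Eq70Squaring
import Literature.MathematicalPhysics.QuantumFieldTheory.Balaban1983to89.B10Eq27TorusAxialLog
import Literature.MathematicalPhysics.QuantumFieldTheory.Balaban1983to89.B5Ineq137Torus

/-!
# `Balaban1983to89.B10Eq71TorusLocal` — [Balaban1985UV3] p. 273, **(67)–(71) FOR ONE LARGE-FIELD PLAQUETTE `p′ ⊂ Λ_j` ON THE TORUS
# CARRIER OF RECORD** `T_η = Setup.Site P 0`: the block `B^j(x₀)`, the translates `(p′)_x` and their sub-plaquettes, the (69) sum and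
# `Δ′(p′)` read on the torus; (70) ⇒ (71) there through the `ℤ^d` kernel of `B10Eq70Squaring`; and the knit with `B10Eq71TorusOverlap`
# — «We get these small factors for all plaquettes in all large fields set P» on the torus with its hypothesis `h71` DISCHARGED

T. Bałaban, *Ultraviolet stability of three-dimensional lattice pure gauge field theories*, Commun. Math. Phys. **102**, 255–275
(1985) [Balaban1985UV3] (cell paper B10; held `paper:balaban1985-cmp102-uv-stability-3d`, journal page = PDF page + 254; p. 273 =
[PDF 19] re-read 2026-08-23 for this file on the text layer `p0019.txt`; p. 256 = [PDF 2] on `p0002.txt`).  «…» = verbatim.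

HONEST FRAMING (mega-formalization `lit-balaban`, verbatim): statement-level skeleton of published theorems with citation tags; proofs
where landed; nothing here is a claim about the Yang–Mills mass gap.

## The printed text (p. 273 [PDF 19])

«To prove the inequality (5) we have to produce all small factors connected with large fields regions P in the functions ζ_{Λ_j}.
Let us take a plaquette p′ ⊂ Λ_j and such that |V_j(∂p′) − 1| ≥ g_jp(g_j). We have  Ū_k^j = V_j on Λ_j, (67)  and the
configuration U_k satisfies the following regularity condition on B^j(Λ_j).  |U_k(∂p) − 1| < O(1)g_jp(q_j)L^{−2j} ⟦sic: p(g_j)⟧. (68)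
Applying the inequalities (50), (53) [4], we have  |Ū_k^j(∂p′) − 1| < Σ_{x∈B^j(x₀)} L^{−3j} Σ_{p⊂(p′)_x} |U_k(∂p) − 1| + O(1)(g_jp(g_j))²,
(69)  where p′ = ⟨x₀, y₀, z₀, w₀⟩, (p′)_x denotes the plaquette p′ transported parallelly to the point x, i.e. the lower left corner
coincides with the point x. Squaring both sides of the above inequality and using (67) yields  |V_j(∂p′) − 1|² < Σ_{x∈B^j(x₀)} L^{−j}
Σ_{p⊂(p′)_x} |U_k(∂p) − 1|² + O(1)(g_jp(g_j))³ ≤ 2 Σ_{p⊂Δ′} L^j[1 − Re tr U_k(∂p)] + O(1)(g_jp(g_j))³, (70)  where Δ′ = B^j(x₀) ∪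
B^j(y₀) ∪ B^j(z₀) ∪ B^j(w₀). This inequality can be written finally as  (1/g_k²) Σ_{p⊂Δ′} η⁻¹[1 − Re tr U_k(∂p)] ≥ (1/2g_j²)|V_j(∂p′)
− 1|² − O(1)g_jp³(g_j) ≥ ½p²(g_j) − O(1)g_jp³(g_j) ≥ ¼p²(g_j) (71)  for g_j sufficiently small. Thus the part of the action
1/g_k²A^η(U_k) localized to the sum of four j-blocks Δ′ connected with the plaquette p′ can be bounded from below by 1/4p²(g_j), and
the corresponding part of the exponential gives the small factor exp(−1/4p²(g_j)). We get these small factors for all plaquettes in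
all large fields set P.»  Context: p. 256 `η = L^{−k}`, `g_k = g(L^kε)^{1/2}` (so `g_k² = g_j²L^{k−j}`); (11) p. 258.

## Why this file exists (unit `lit-balaban-r07`, reader/typer and fold owner of B10; gen 56; rows B10.Eq69–Eq71 members)

`B10Eq70Squaring` (this unit, gen 6) proves (69) ⇒ (70) ⇒ (71) on the MODEL fine lattice `ℤ^d` of [4] = [Balaban1985Averaging]
(`B7Prop1Explicit`), where the block, the translates and `Δ′` are integer boxes; `B10Eq71TorusOverlap` (this unit, gen 55) proves the
OVERLAP bookkeeping behind «for all plaquettes in all large fields set P» on the torus carrier of record with `Δ′(p′) = deltaT j p′` WITH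
BODY, but takes the per-plaquette (71) there as a hypothesis `h71` (its HONEST SCOPE (i): «a torus transport of (69)–(71) is not
attempted»).  THIS FILE IS THAT TRANSPORT.  Print's carrier IS the torus (`p′ ⊂ Λ_j ⊂ T^{(j)}`, `U_k` on `T_η`):

* §1 the base corner `x₀♭ = fine P j c` of the block `B^j(c) = {y : blockIter j y = c}` (fine labels `L^j·c`), the translates
  `x₀♭ + z` by integer vectors (`B10Eq27TorusAxialLog.transl`, BY NAME) and **THE LABEL IDENTITY** `blockIter j (x₀♭ + z) =
  c + Σ_κ ⌊z_κ/L^j⌋e_κ` for `z ≥ 0` (`blockIter_transl_fine`: `((L^jc + z) mod L^jN)/L^j = (c + ⌊z/L^j⌋) mod N` on the labels,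
  wrap-around INCLUDED; `sitesPerDir 0 = L^j · sitesPerDir j`); no wrap-around of a box of side `2L^j` (`2L^j ≤ 2L^{m+K}` IS the
  standing range, no extra hypothesis; `transl_injOn`);
* §2 the fine plaquette `plaqAt p′ z = ⟨x₀♭ + z; μ, ν⟩` parallel to `p′`: **every point `z` of the `ℤ^d` box `deltaBox L^j 0 μ ν` of
  `B10Eq70Squaring` (PROVED there equal to «B^j(x₀) ∪ B^j(y₀) ∪ B^j(z₀) ∪ B^j(w₀)») names a fine plaquette of `Δ′(p′) = deltaT j p′`**
  (`plaqAt_mem_deltaT`: its `j`-block is `c + a e_μ + b e_ν`, `a, b ∈ {0,1}`, one of the four corners `cornersJ p′`), in particular every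
  sub-plaquette `p ⊂ (p′)_x` does (`plaqAt_corner_mem_deltaT`); `plaqAt p′` is injective on the box (`plaqAt_injOn_deltaBox`), hence
  **`Σ_{z∈box} G(plaqAt p′ z) ≤ Σ_{q∈Δ′(p′)} G(q)`** for `G ≥ 0` (`sum_deltaBox_le_sum_deltaT`);
* §3 **THE (69) SUM ON THE TORUS** `blockSumT j p′ F = Σ_{x∈B^j(x₀)} L^{−dj} Σ_{p⊂(p′)_x} F(p)` := `B10Eq70Squaring.blockSum` of the
  pulled-back plaquette function (`blockSumT_eq` displays the printed triple sum; `plaqAt_src_add`: the sub-plaquettes of `(p′)_x` sit at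
  `x + i e_μ + i′ e_ν`, «the lower left corner coincides with the point x»);
* §4 **(70) ON THE TORUS** (`sq_le_of_le69_torus`, `…_d3`: Jensen over the block, Cauchy–Schwarz over the `L^{2j}` sub-plaquettes, the
  multiplicity `L^{2j}` — `B10Eq70Squaring.sq_le_of_le69` for the pulled-back functions — then §2) and **(67)–(71) FOR ONE LARGE-FIELD
  PLAQUETTE ON THE TORUS** (`smallFactor_of_largeField_torus`, `exp_localized_le_torus`): hypotheses AS PRINTED in the cell's letters —
  (67) `plaqHol (Averaging.iter av j U_k) p′ = plaqHol V_j p′` with `Setup.Averaging.iter` (the cell's axiomatised `j`-fold average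
  `Ū_k^j`), the large-field condition `g_jp(g_j) ≤ dist1 (plaqHol V_j p′)`, (68) on the fine plaquettes of `Δ′(p′) ⊆ B^j(Λ_j)`, (69)
  non-strict with remainder `b ≤ C₂(g_jp(g_j))²`, (11) as `dist1(·)² ≤ 2·act`, `g_k² = g_j²L^{k−j}`, «g_j sufficiently small» explicit ⇒
  `¼p²(g_j) ≤ (1/g_k²)·L^k·Σ_{q∈Δ′(p′)} act(q)`; (71) itself is `B10Eq70Squaring.ineq71` BY NAME (real arithmetic);
* §5 the cell's `U(N)` and `SU(N)` (`UnitaryModel.instGaugeGroupUnitaryGroup` / `…SpecialUnitaryGroup`): (11) `dist1 W² ≤ 2N(1 − reTr W)`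
  from `B10Eq11Trace.eq11_opNorm` (`dist1_sq_le_unitaryGroup`, `dist1_sq_le_specialUnitaryGroup`), so `act(q) = N(1 − Re tr U_k(∂q))`
  (`smallFactor_of_largeField_torus_unitaryGroup` / `…_specialUnitaryGroup`; dimension factor of cell DIVERGENCE D-b10.1);
* §6 **THE KNIT** (`quarter_sum_le_of_printed_torus`, `smallFactorsAll_of_printed_torus`): the hypothesis `h71` of
  `B10Eq71TorusOverlap.quarter_sum_le_of_local71_torus` / `smallFactorsAll_shape_torus` DISCHARGED from the per-plaquette printed inputs —
  «We get these small factors for all plaquettes in all large fields set P»: **`¼·Σ_{j∈J}Σ_{p′∈S′_j} ¼p²(g_j) ≤ (1/g_k²)·η⁻¹·Σ_{q∈Y} act(q)`**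
  on the torus carrier of record with `c₁ = ¼`, END TO END modulo (67)–(69) per plaquette;
* §7 in the cell's letters for `U(N)` / `SU(N)` with `Y` = all fine plaquettes: **`¼·Σ_{j∈J}Σ_{p′∈S′_j} ¼p²(g_j) ≤ (N/g_k²)·A^η(U_k)`** with
  `A^η(U_k) = Setup.wilsonAction (L^k) U_k` (`quarter_sum_le_wilsonAction_unitaryGroup` / `…_specialUnitaryGroup`; p. 256, the display after (5):
  «A^η(U_k(U)) = Σ_{p⊂T_η} η^{−1}[1 − Re tr U_k(U, ∂p)], η = L^{−k}» — `Setup.wilsonAction`'s weight `η^{d−4}` of [Balaban1987RG1] (0.2) at `d = 3`).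

DICTIONARY print ↦ Lean: `T_η` ↦ `Site P 0`, `T^{(j)}` ↦ `Site P j`, `p′ = ⟨x₀, y₀, z₀, w₀⟩ ⊂ Λ_j` ↦ `p′ : Plaq P j` (`p′.src = x₀` as a
level-`j` site, directions `p′.μ < p′.ν`); the fine base corner of `B^j(x₀)` ↦ `B5Ineq137Torus.fine P j p′.src`; `x ∈ B^j(x₀)` ↦ `x₀♭ + boxVec r`,
`r : Fin d → Fin L^j`; `p ⊂ (p′)_x` ↦ `plaqAt p′ (boxVec r + i e_μ + i′ e_ν)`, `(r, i, i′) : B10Eq70Squaring.Idx d L^j`; `Δ′` ↦ `deltaT j p′`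
(`B10Eq71TorusOverlap`); `|U_k(∂p) − 1|` ↦ `dist1 (GaugeField.plaqHol U p)`; `Ū_k^j` ↦ `Averaging.iter av j U`; `V_j` ↦ `Vj : GaugeField P j G`;
the (69) sum ↦ `blockSumT j p′ (dist1 ∘ plaqHol U)`; `1 − Re tr U_k(∂p)` ↦ `act` with (11) `dist1² ≤ 2·act` (§5: `N(1 − reTr ·)` for `U(N)`);
`g_jp(g_j)`, `g_k`, `O(1)` ↦ reals `gj * p`, `gk`, `C₁`, `C₂`; `η⁻¹` ↦ `L^k`; `L^{−3j}` ↦ `((L^j)^d)⁻¹` with `d = P.d` (`= 3` where printed).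

HONEST SCOPE. (i) (67), (68), (69) enter AS HYPOTHESES, exactly as in `B10Eq70Squaring` ((69) is certified concretely only on the `ℤ^d`
model, `B10Eq69Concrete` / `B10Eq71Concrete`; a torus (69) from (50), (53) of [4] is NOT derived here); (69) is taken non-strict (print:
`<`).  (ii) (68) is assumed on the fine plaquettes of `Δ′(p′)` (print: «on B^j(Λ_j)», which contains `Δ′(p′)` since the corners of `p′`
lie in `Λ_j`); only the sub-plaquettes of the translates are used.  (iii) `Δ′(p′)` = the fine plaquettes PARALLEL to `p′` with lower-left
corner in the four corner blocks (the reading of `B10Eq70Squaring` / `B10Eq71TorusOverlap`); (71) holds a fortiori for larger plaquette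
sets.  (iv) The averaging `av` is the cell's axiomatised `Setup.Averaging` (any instance; print's is (15) of [4]); it enters only through
(67)/(69).  (v) `P.d` is free except where the printed exponents are displayed (`d = 3`: `(L^{3j})⁻¹L^{4j} = L^j`).  (vi) Nothing of
[Balaban1985UV3] beyond the quoted passage is asserted; `B10Eq70Squaring`, `B10Eq71TorusOverlap`, `B10Eq27TorusAxialLog` (`transl`),
`B14.Eq213DetSet` (`val_blockIter`), `B5Ineq137Torus` (`fine`, `fine_val`, `pow_mul_sitesPerDir`), `B10Eq11Trace` are used BY NAME,
byte-identical.

WHAT THIS FILE PROVES (kernel, no `sorry`, no named facts, no structures; definitions with bodies `plaqAt`, `pullFn`,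
`blockSumT`; theorems otherwise; axioms standard).  Value = rows B10.Eq69/Eq70/Eq71 gain their member “(67)–(71) for one large-field
plaquette” ON THE CARRIER OF RECORD, and the gen-55 knit «for all plaquettes in all large fields set P» on the torus loses its hypothesis
`h71`; NOT summit progress.
-/
noncomputable section

open scoped BigOperators

namespace Literature.MathematicalPhysics.QuantumFieldTheory.Balaban1983to89.B10Eq71TorusLocal

open B7Prop1Explicit renaming Site → LSite
open B7Prop1Explicit (e e_apply boxVec)
open B10Eq70Squaring (Idx corner side deltaBox mem_deltaBox corner_mem_deltaBox blockSum innerSum blockSum_eq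
  blockSum_nonneg blockSum_sq_le sq_le_of_le69 ineq71)
open B10Eq27TorusAxialLog (transl transl_apply transl_zero transl_add transl_add_e)
open B10Eq71TorusOverlap (cornersJ deltaT mem_deltaT_iff)
open B14.Eq22Determines (blockIter)
open B5Ineq137Torus (fine fine_val pow_mul_sitesPerDir)

variable {P : Params}

/-! ## §1 The base corner of a block (`B5Ineq137Torus.fine`) and the label arithmetic of its integer translates -/

section Labels

variable {j : ℕ}

/-- The label of the translate `x₀ + z` of the base corner by a non-negative integer vector: `(L^j c_κ + z_κ) mod 2L^{m+K}`.
[cite: Balaban1985UV3, (69) p.273] -/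
theorem val_transl_fine (hj : j ≤ P.m + P.K) (c : Site P j) {z : LSite P.d} (hz : ∀ κ, 0 ≤ z κ) (κ : Fin P.d) :
    ((transl (fine P j c) z) κ).val = (P.L ^ j * (c κ).val + (z κ).toNat) % P.sitesPerDir 0 := by
  rw [transl_apply]
  have hzc : ((z κ : ℤ) : ZMod (P.sitesPerDir 0)) = (((z κ).toNat : ℕ) : ZMod (P.sitesPerDir 0)) := by
    rw [← Int.cast_natCast, Int.toNat_of_nonneg (hz κ)]
  rw [hzc, ← ZMod.natCast_zmod_val ((fine P j c) κ), fine_val P hj, ← Nat.cast_add, ZMod.val_natCast]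

/-- **THE KEY LABEL IDENTITY**: the `j`-block of the fine site `x₀ + z` (`x₀` the base corner of `B^j(c)`, `z ≥ 0`) is
`c + Σ_κ ⌊z_κ / L^j⌋ e_κ` in `T^{(j)}` — wrap-around included (`(L^j c + z) mod (L^j N) / L^j = (c + ⌊z/L^j⌋) mod N`).
[cite: Balaban1985UV3, (69)–(70) p.273] -/
theorem blockIter_transl_fine (hj : j ≤ P.m + P.K) (c : Site P j) {z : LSite P.d} (hz : ∀ κ, 0 ≤ z κ) :
    blockIter j (transl (fine P j c) z) =
      fun κ => c κ + (((z κ).toNat / P.L ^ j : ℕ) : ZMod (P.sitesPerDir j)) := by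
  funext κ
  have hval : ((blockIter j (transl (fine P j c) z)) κ).val = ((c κ).val + (z κ).toNat / P.L ^ j) % P.sitesPerDir j := by
    rw [B14.Eq213DetSet.val_blockIter hj, val_transl_fine hj c hz κ, ← pow_mul_sitesPerDir P hj,
      Nat.mod_mul_right_div_self, Nat.mul_add_div (pow_pos P.L_pos _)]
  calc (blockIter j (transl (fine P j c) z)) κ
      = ((((blockIter j (transl (fine P j c) z)) κ).val : ℕ) : ZMod (P.sitesPerDir j)) :=
        (ZMod.natCast_zmod_val _).symm
    _ = ((((c κ).val + (z κ).toNat / P.L ^ j) % P.sitesPerDir j : ℕ) : ZMod (P.sitesPerDir j)) := by rw [hval]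
    _ = c κ + (((z κ).toNat / P.L ^ j : ℕ) : ZMod (P.sitesPerDir j)) := by
        rw [ZMod.natCast_mod, Nat.cast_add, ZMod.natCast_zmod_val]

/-- Translation by non-negative vectors with entries below the site count is injective (no wrap-around).
(bookkeeping of the torus sites of [Balaban1987RG1] (0.1), no content of the series) [cite: Balaban1987RG1, (0.1) p.251] -/
theorem transl_injOn (x : Site P 0) :
    Set.InjOn (fun z : LSite P.d => transl x z) {z | ∀ κ, 0 ≤ z κ ∧ z κ < P.sitesPerDir 0} := by
  intro z hz z' hz' h
  funext κ
  have hκ : transl x z κ = transl x z' κ := congrFun h κ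
  rw [transl_apply, transl_apply, add_right_inj] at hκ
  obtain ⟨h0, hlt⟩ := hz κ
  obtain ⟨h0', hlt'⟩ := hz' κ
  have e1 : (z κ : ℤ) = ((z κ).toNat : ℕ) := (Int.toNat_of_nonneg h0).symm
  have e2 : (z' κ : ℤ) = ((z' κ).toNat : ℕ) := (Int.toNat_of_nonneg h0').symm
  rw [e1, e2, Int.cast_natCast, Int.cast_natCast, ZMod.natCast_eq_natCast_iff'] at hκ
  have h1 : (z κ).toNat < P.sitesPerDir 0 := by omega
  have h2 : (z' κ).toNat < P.sitesPerDir 0 := by omega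
  rw [Nat.mod_eq_of_lt h1, Nat.mod_eq_of_lt h2] at hκ
  omega

end Labels

/-! ## §2 The translates of `p′` and their sub-plaquettes are fine plaquettes of `Δ′(p′)` -/

section Delta

variable {j : ℕ}

/-- The fine plaquette PARALLEL to `p′` with lower-left corner `x₀ + z`, `x₀` the base corner of `B^j(p′.src)` (p. 273: the
sub-plaquettes `p ⊂ (p′)_x` of «the plaquette p′ transported parallelly to the point x» have this form with
`z = (x − x₀) + i e_μ + i′ e_ν`). [cite: Balaban1985UV3, (69) p.273] -/
def plaqAt (p : Plaq P j) (z : LSite P.d) : Plaq P 0 :=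
  ⟨transl (fine P j p.src) z, p.μ, p.ν, p.hμν⟩

/-- Its lower-left corner. [cite: Balaban1985UV3, (69) p.273] -/
@[simp] theorem plaqAt_src (p : Plaq P j) (z : LSite P.d) : (plaqAt p z).src = transl (fine P j p.src) z := rfl

/-- Its directions are those of `p′`. [cite: Balaban1985UV3, (69) p.273] -/
@[simp] theorem plaqAt_μ (p : Plaq P j) (z : LSite P.d) : (plaqAt p z).μ = p.μ := rfl

/-- Its directions are those of `p′`. [cite: Balaban1985UV3, (69) p.273] -/
@[simp] theorem plaqAt_ν (p : Plaq P j) (z : LSite P.d) : (plaqAt p z).ν = p.ν := rfl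

/-- A site of `T^{(j)}` of the form `c + Σ_κ q_κ e_κ` with `q_μ, q_ν ∈ {0, 1}` and `q_κ = 0` otherwise is one of the four corners
`x₀, y₀, z₀, w₀` of the plaquette `p′` at `c` spanned by `e_μ, e_ν`. [cite: Balaban1985UV3, (70) p.273] -/
theorem mem_cornersJ_of (p : Plaq P j) (q : Fin P.d → ℕ) (hμ : q p.μ ≤ 1) (hν : q p.ν ≤ 1)
    (h0 : ∀ κ, κ ≠ p.μ → κ ≠ p.ν → q κ = 0) :
    (fun κ => p.src κ + (q κ : ZMod (P.sitesPerDir j))) ∈ cornersJ p := by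
  have hμν : p.μ ≠ p.ν := ne_of_lt p.hμν
  -- one lattice step in indicator form: `(x + e_μ)_κ = x_κ + [κ = μ]`
  have hs : ∀ (x : Site P j) (μ κ : Fin P.d), x.shift μ κ = x κ + if κ = μ then 1 else 0 := by
    intro x μ κ
    rw [Site.shift_apply]
    split_ifs with h
    · rw [h]
    · rw [add_zero]
  have key : ∀ κ, (q κ : ZMod (P.sitesPerDir j)) =
      (if κ = p.μ then (q p.μ : ZMod (P.sitesPerDir j)) else 0) +
        (if κ = p.ν then (q p.ν : ZMod (P.sitesPerDir j)) else 0) := by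
    intro κ
    by_cases h1 : κ = p.μ
    · subst h1; rw [if_pos rfl, if_neg hμν, add_zero]
    · by_cases h2 : κ = p.ν
      · subst h2; rw [if_neg h1, if_pos rfl, zero_add]
      · rw [if_neg h1, if_neg h2, add_zero, h0 κ h1 h2, Nat.cast_zero]
  have hmem : ∀ y : Site P j, y = p.src ∨ y = p.src.shift p.μ ∨ y = p.src.shift p.ν ∨ y = (p.src.shift p.μ).shift p.ν →
      y ∈ cornersJ p := by
    intro y hy
    unfold cornersJ
    rcases hy with rfl | rfl | rfl | rfl
    · exact Finset.mem_insert_self _ _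
    · exact Finset.mem_insert_of_mem (Finset.mem_insert_self _ _)
    · exact Finset.mem_insert_of_mem (Finset.mem_insert_of_mem (Finset.mem_insert_self _ _))
    · exact Finset.mem_insert_of_mem (Finset.mem_insert_of_mem (Finset.mem_insert_of_mem (Finset.mem_singleton_self _)))
  apply hmem
  rcases Nat.le_one_iff_eq_zero_or_eq_one.mp hμ with ha | ha <;>
    rcases Nat.le_one_iff_eq_zero_or_eq_one.mp hν with hb | hb
  · refine Or.inl (funext fun κ => ?_)
    rw [key κ, ha, hb]; push_cast; split_ifs <;> ring
  · refine Or.inr (Or.inr (Or.inl (funext fun κ => ?_)))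
    rw [key κ, ha, hb, hs]; push_cast; split_ifs <;> ring
  · refine Or.inr (Or.inl (funext fun κ => ?_))
    rw [key κ, ha, hb, hs]; push_cast; split_ifs <;> ring
  · refine Or.inr (Or.inr (Or.inr (funext fun κ => ?_)))
    rw [key κ, ha, hb, hs, hs]; push_cast; split_ifs <;> ring

/-- **EVERY POINT OF THE BOX NAMES A FINE PLAQUETTE OF `Δ′(p′)`**: for `z ∈ deltaBox L^j 0 μ ν` (`0 ≤ z_κ < 2L^j` in the directions of
`p′`, `< L^j` otherwise — the `ℤ^d` box PROVED in `B10Eq70Squaring.deltaBox_eq_union_blocks` to be «B^j(x₀) ∪ B^j(y₀) ∪ B^j(z₀) ∪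
B^j(w₀)») the fine plaquette `plaqAt p′ z` lies in `deltaT j p′` — its `j`-block is one of the four corners of `p′` (standing range).
[cite: Balaban1985UV3, (70) p.273] -/
theorem plaqAt_mem_deltaT (hj : j ≤ P.m + P.K) (p : Plaq P j) {z : LSite P.d}
    (hz : z ∈ deltaBox (P.L ^ j) (0 : LSite P.d) p.μ p.ν) : plaqAt p z ∈ deltaT j p := by
  rw [mem_deltaBox] at hz
  simp only [sub_zero] at hz
  have hz0 : ∀ κ, 0 ≤ z κ := fun κ => (hz κ).1
  have hn : 0 < P.L ^ j := pow_pos P.L_pos _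
  refine mem_deltaT_iff.mpr ⟨rfl, rfl, ?_⟩
  rw [plaqAt_src, blockIter_transl_fine hj p.src hz0]
  refine mem_cornersJ_of p (fun κ => (z κ).toNat / P.L ^ j) ?_ ?_ ?_
  · have h := (hz p.μ).2
    unfold side at h
    rw [if_pos (Or.inl rfl)] at h
    have h2 : (z p.μ).toNat < 2 * P.L ^ j := by have := hz0 p.μ; omega
    have := (Nat.div_lt_iff_lt_mul hn).mpr h2
    omega
  · have h := (hz p.ν).2
    unfold side at h
    rw [if_pos (Or.inr rfl)] at h
    have h2 : (z p.ν).toNat < 2 * P.L ^ j := by have := hz0 p.ν; omega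
    have := (Nat.div_lt_iff_lt_mul hn).mpr h2
    omega
  · intro κ h1 h2
    have h := (hz κ).2
    unfold side at h
    rw [if_neg (not_or.mpr ⟨h1, h2⟩)] at h
    have h3 : (z κ).toNat < P.L ^ j := by have := hz0 κ; omega
    exact Nat.div_eq_of_lt h3

/-- In particular every sub-plaquette `p ⊂ (p′)_x`, `x ∈ B^j(x₀)` — index `t = (r, i, i′)`, corner `x₀ + boxVec r + i e_μ + i′ e_ν` — is a
fine plaquette of `Δ′(p′)` (`B10Eq70Squaring.corner_mem_deltaBox`). [cite: Balaban1985UV3, (69)–(70) p.273] -/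
theorem plaqAt_corner_mem_deltaT (hj : j ≤ P.m + P.K) (p : Plaq P j) (t : Idx P.d (P.L ^ j)) :
    plaqAt p (corner (P.L ^ j) (0 : LSite P.d) p.μ p.ν t) ∈ deltaT j p :=
  plaqAt_mem_deltaT hj p (corner_mem_deltaBox (P.L ^ j) 0 p.μ p.ν (ne_of_lt p.hμν) t)

/-- **NO WRAP-AROUND**: `z ↦ plaqAt p′ z` is injective on the box (its sides `≤ 2L^j ≤ 2L^{m+K}` = sites per direction of `T_η`;
standing range, no further hypothesis). [cite: Balaban1985UV3, (70) p.273] -/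
theorem plaqAt_injOn_deltaBox (hj : j ≤ P.m + P.K) (p : Plaq P j) :
    Set.InjOn (plaqAt p) (deltaBox (P.L ^ j) (0 : LSite P.d) p.μ p.ν : Finset (LSite P.d)) := by
  intro z hz z' hz' h
  -- no wrap-around: `2L^j ≤ 2L^{m+K}` = sites per direction of `T_η` in the standing range (the tree's
  -- `BIJ85ScalarPropagatorSupDecayDeriv.two_mul_pow_le_sitesPerDir`, re-derived in two lines rather than importing that file)
  have hN : 2 * P.L ^ j ≤ P.sitesPerDir 0 := by
    unfold Params.sitesPerDir
    have h : P.L ^ j ≤ P.L ^ (P.m + P.K - 0) := Nat.pow_le_pow_right P.L_pos (by omega)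
    omega
  have hside : ∀ κ, side (P.L ^ j) p.μ p.ν κ ≤ 2 * P.L ^ j := by
    intro κ; unfold side; split_ifs <;> omega
  have hbox : ∀ {w : LSite P.d}, w ∈ deltaBox (P.L ^ j) (0 : LSite P.d) p.μ p.ν →
      ∀ κ, 0 ≤ w κ ∧ w κ < P.sitesPerDir 0 := by
    intro w hw κ
    rw [mem_deltaBox] at hw
    have h := hw κ
    simp only [sub_zero] at h
    refine ⟨h.1, lt_of_lt_of_le h.2 ?_⟩
    exact_mod_cast (hside κ).trans hN
  have hsrc : transl (fine P j p.src) z = transl (fine P j p.src) z' := congrArg Plaq.src h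
  exact transl_injOn (fine P j p.src) (hbox (Finset.mem_coe.mp hz)) (hbox (Finset.mem_coe.mp hz')) hsrc

/-- **THE BOX SUM IS DOMINATED BY THE `Δ′(p′)` SUM**: for `G ≥ 0` on `Δ′(p′)`, `Σ_{z ∈ box} G(plaqAt p′ z) ≤ Σ_{q ∈ Δ′(p′)} G(q)`
(injectivity + membership; in fact the image is all of `Δ′(p′)`, not needed). [cite: Balaban1985UV3, (70) p.273] -/
theorem sum_deltaBox_le_sum_deltaT (hj : j ≤ P.m + P.K) (p : Plaq P j) {G : Plaq P 0 → ℝ}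
    (hG : ∀ q ∈ deltaT j p, 0 ≤ G q) :
    ∑ z ∈ deltaBox (P.L ^ j) (0 : LSite P.d) p.μ p.ν, G (plaqAt p z) ≤ ∑ q ∈ deltaT j p, G q := by
  classical
  rw [← Finset.sum_image (plaqAt_injOn_deltaBox hj p)]
  refine Finset.sum_le_sum_of_subset_of_nonneg ?_ fun q hq _ => hG q hq
  intro q hq
  obtain ⟨z, hz, rfl⟩ := Finset.mem_image.mp hq
  exact plaqAt_mem_deltaT hj p hz

end Delta

/-! ## §3 The (69) sum on the torus -/

section BlockSum

variable {j : ℕ}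

/-- The plaquette function pulled back to the box: `F♯(z) := F(plaqAt p′ z)`. [cite: Balaban1985UV3, (69) p.273] -/
def pullFn (p : Plaq P j) (F : Plaq P 0 → ℝ) : LSite P.d → ℝ := fun z => F (plaqAt p z)

/-- Unfolding `pullFn`. [cite: Balaban1985UV3, (69) p.273] -/
@[simp] theorem pullFn_apply (p : Plaq P j) (F : Plaq P 0 → ℝ) (z : LSite P.d) : pullFn p F z = F (plaqAt p z) := rfl

/-- **THE RIGHT-HAND SIDE SUM OF (69) ON THE TORUS**: `S = Σ_{x∈B^j(x₀)} L^{−dj} Σ_{p⊂(p′)_x} F(p)` for a plaquette function `F` on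
`T_η` (print: `F(p) = |U_k(∂p) − 1|`, `d = 3`), the block points `x = x₀ + boxVec r` and the sub-plaquettes of the translate `(p′)_x`
at `x + i e_μ + i′ e_ν`, `0 ≤ i, i′ < L^j` — by definition the `ℤ^d` block sum `B10Eq70Squaring.blockSum` of the pulled-back function at
the base point `0` (`blockSumT_eq` displays it). [cite: Balaban1985UV3, (69) p.273] -/
def blockSumT (j : ℕ) (p : Plaq P j) (F : Plaq P 0 → ℝ) : ℝ :=
  blockSum (P.L ^ j) (0 : LSite P.d) p.μ p.ν (pullFn p F)

/-- `blockSumT` displayed as the printed triple sum `Σ_{x∈B^j(x₀)} L^{−dj} Σ_i Σ_{i′} F(⟨x + i e_μ + i′ e_ν; μ, ν⟩)`.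
[cite: Balaban1985UV3, (69) p.273] -/
theorem blockSumT_eq (p : Plaq P j) (F : Plaq P 0 → ℝ) :
    blockSumT j p F = ∑ r : Fin P.d → Fin (P.L ^ j), (((P.L ^ j : ℕ) : ℝ) ^ P.d)⁻¹ *
      ∑ i : Fin (P.L ^ j), ∑ i' : Fin (P.L ^ j),
        F (plaqAt p (boxVec (P.L ^ j) r + ((i : ℕ) : ℤ) • e p.μ + ((i' : ℕ) : ℤ) • e p.ν)) := by
  unfold blockSumT
  rw [blockSum_eq]
  refine Finset.sum_congr rfl fun r _ => ?_
  congr 1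
  refine Finset.sum_congr rfl fun i _ => Finset.sum_congr rfl fun i' _ => ?_
  simp [corner, pullFn]

/-- The sub-plaquettes of the translate `(p′)_x`, `x = x₀ + boxVec r`, sit at `x + (i e_μ + i′ e_ν)`: the corner of `plaqAt p′ (boxVec r + v)`
is the translate by `v` of the block point `x₀ + boxVec r` («transported parallelly to the point x, i.e. the lower left corner coincides
with the point x»). [cite: Balaban1985UV3, (69) p.273] -/
theorem plaqAt_src_add (p : Plaq P j) (w v : LSite P.d) :
    (plaqAt p (w + v)).src = transl (transl (fine P j p.src) w) v := by
  rw [plaqAt_src, transl_add]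

/-- `S ≥ 0` for `F ≥ 0`. [cite: Balaban1985UV3, (69) p.273] -/
theorem blockSumT_nonneg (p : Plaq P j) {F : Plaq P 0 → ℝ} (hF : ∀ q, 0 ≤ F q) : 0 ≤ blockSumT j p F :=
  blockSum_nonneg (P.L ^ j) 0 p.μ p.ν fun _ => hF _

end BlockSum

/-! ## §4 (70) and (71) on the torus -/

section Squaring

variable {j : ℕ}

/-- **(70) ON THE TORUS, second line through the action density, from a NON-STRICT (69)**: for `F ≥ 0` on the fine plaquettes with
`F(q)² ≤ 2·act(q)` on `Δ′(p′)` ((11) p. 258), `v ≤ S + b` ((69) with (67): `v = |V_j(∂p′) − 1|`), `0 ≤ b ≤ B` and (68) in the form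
`F ≤ A·L^{−2j}` on the sub-plaquettes of the translates:
`v² ≤ 2·((L^{dj})⁻¹L^{4j})·Σ_{q∈Δ′(p′)} act(q) + (2AB + B²)` — `B10Eq70Squaring.sq_le_of_le69` (Jensen, Cauchy–Schwarz, multiplicity `L^{2j}`)
for the pulled-back functions, then `sum_deltaBox_le_sum_deltaT`. [cite: Balaban1985UV3, (70) p.273] -/
theorem sq_le_of_le69_torus (hj : j ≤ P.m + P.K) (p : Plaq P j) {F act : Plaq P 0 → ℝ} (hF : ∀ q, 0 ≤ F q)
    (hact : ∀ q ∈ deltaT j p, F q ^ 2 ≤ 2 * act q) {v b A B : ℝ} (hv : 0 ≤ v)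
    (h69 : v ≤ blockSumT j p F + b) (hb : 0 ≤ b) (hbB : b ≤ B)
    (h68 : ∀ t : Idx P.d (P.L ^ j), F (plaqAt p (corner (P.L ^ j) (0 : LSite P.d) p.μ p.ν t)) ≤
      A / (((P.L ^ j : ℕ) : ℝ)) ^ 2) :
    v ^ 2 ≤ 2 * (((((P.L ^ j : ℕ) : ℝ)) ^ P.d)⁻¹ * (((P.L ^ j : ℕ) : ℝ)) ^ 4) * (∑ q ∈ deltaT j p, act q) +
      (2 * A * B + B ^ 2) := by
  have hn : 1 ≤ P.L ^ j := Nat.one_le_pow _ _ P.L_pos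
  have hμν : p.μ ≠ p.ν := ne_of_lt p.hμν
  have hact' : ∀ z ∈ deltaBox (P.L ^ j) (0 : LSite P.d) p.μ p.ν, pullFn p F z ^ 2 ≤ 2 * pullFn p act z :=
    fun z hz => hact _ (plaqAt_mem_deltaT hj p hz)
  have h := sq_le_of_le69 (P.L ^ j) (0 : LSite P.d) p.μ p.ν hn hμν (F := pullFn p F) (act := pullFn p act)
    (fun z => hF _) hact' hv h69 hb hbB (fun t => h68 t)
  have hact0 : ∀ q ∈ deltaT j p, 0 ≤ act q := fun q hq => by nlinarith [hact q hq, sq_nonneg (F q)]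
  have hsum := sum_deltaBox_le_sum_deltaT hj p (G := act) hact0
  have hc : 0 ≤ 2 * (((((P.L ^ j : ℕ) : ℝ)) ^ P.d)⁻¹ * (((P.L ^ j : ℕ) : ℝ)) ^ 4) := by positivity
  have := mul_le_mul_of_nonneg_left hsum hc
  simp only [pullFn_apply] at h
  linarith

/-- **(70) with the printed exponents** (`d = 3`): `(L^{3j})⁻¹L^{4j} = L^j`, so `v² ≤ 2L^j·Σ_{q∈Δ′(p′)} act(q) + (2AB + B²)` — print's
«≤ 2 Σ_{p⊂Δ′} L^j[1 − Re tr U_k(∂p)] + O(1)(g_jp(g_j))³». [cite: Balaban1985UV3, (70) p.273] -/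
theorem sq_le_of_le69_torus_d3 (hd : P.d = 3) (hj : j ≤ P.m + P.K) (p : Plaq P j) {F act : Plaq P 0 → ℝ}
    (hF : ∀ q, 0 ≤ F q) (hact : ∀ q ∈ deltaT j p, F q ^ 2 ≤ 2 * act q) {v b A B : ℝ} (hv : 0 ≤ v)
    (h69 : v ≤ blockSumT j p F + b) (hb : 0 ≤ b) (hbB : b ≤ B)
    (h68 : ∀ t : Idx P.d (P.L ^ j), F (plaqAt p (corner (P.L ^ j) (0 : LSite P.d) p.μ p.ν t)) ≤
      A / ((P.L : ℝ) ^ j) ^ 2) :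
    v ^ 2 ≤ 2 * (P.L : ℝ) ^ j * (∑ q ∈ deltaT j p, act q) + (2 * A * B + B ^ 2) := by
  have hLj : (((P.L ^ j : ℕ) : ℝ)) = (P.L : ℝ) ^ j := by push_cast; ring
  have hL0 : (P.L : ℝ) ^ j ≠ 0 := pow_ne_zero _ (by exact_mod_cast P.L_pos.ne')
  have h68' : ∀ t : Idx P.d (P.L ^ j), F (plaqAt p (corner (P.L ^ j) (0 : LSite P.d) p.μ p.ν t)) ≤
      A / (((P.L ^ j : ℕ) : ℝ)) ^ 2 := by intro t; rw [hLj]; exact h68 t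
  have h := sq_le_of_le69_torus hj p hF hact hv h69 hb hbB h68'
  have e2 : ((((P.L ^ j : ℕ) : ℝ)) ^ P.d)⁻¹ * (((P.L ^ j : ℕ) : ℝ)) ^ 4 = (P.L : ℝ) ^ j := by
    rw [hLj, hd]; field_simp
  rw [e2] at h
  linarith

variable {G : Type*} [GaugeGroup G]

/-- **SECT. D, (67)–(71) p. 273 FOR ONE LARGE-FIELD PLAQUETTE ON THE TORUS CARRIER OF RECORD** (`d = 3`, standing range `j ≤ m + K`,
`j ≤ k`).  Data: the fine configuration `U = U_k` on `T_η = Site P 0` (values in the cell's gauge group `G`, `|·| = dist1`), a level-`j`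
plaquette `p′ ⊂ Λ_j` and the field `V_j` on `T^{(j)}`, the cell's axiomatised averaging operations `av` with `j`-fold iterate
`Ū_k^j = Averaging.iter av j U_k`, an action density `act` on the fine plaquettes with (11) in the form `|U(∂q) − 1|² ≤ 2·act(q)` on `Δ′(p′)`.
Hypotheses AS PRINTED: **(67)** `Ū_k^j(∂p′) = V_j(∂p′)`; the large-field condition «|V_j(∂p′) − 1| ≥ g_jp(g_j)»; **(68)**
`|U_k(∂q) − 1| ≤ C₁g_jp(g_j)L^{−2j}` on the fine plaquettes of `Δ′(p′) ⊆ B^j(Λ_j)`; **(69)** (non-strict, as the tree certifies (50)/(53) of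
[4]) `|Ū_k^j(∂p′) − 1| ≤ Σ_{x∈B^j(x₀)} L^{−3j} Σ_{p⊂(p′)_x} |U_k(∂p) − 1| + b`, `0 ≤ b ≤ C₂(g_jp(g_j))²`; `g_k² = g_j²L^{k−j}`; `g_jp(g_j) ≤ 1`;
«for g_j sufficiently small» = `½(2C₁C₂ + C₂²)g_jp(g_j) ≤ ¼`.  THEN **`¼p²(g_j) ≤ (1/g_k²)·η⁻¹·Σ_{q∈Δ′(p′)} act(q)`** (`η⁻¹ = L^k`): «the part
of the action 1/g_k²A^η(U_k) localized to the sum of four j-blocks Δ′ connected with the plaquette p′ can be bounded from below by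
1/4p²(g_j)». (70) is `sq_le_of_le69_torus_d3`, (71) is `B10Eq70Squaring.ineq71` (real arithmetic, BY NAME).
[cite: Balaban1985UV3, (67)–(71) p.273] -/
theorem smallFactor_of_largeField_torus (hd : P.d = 3) (hj : j ≤ P.m + P.K) {k : ℕ} (hjk : j ≤ k)
    (av : ∀ i, Averaging P i G) (U : GaugeField P 0 G) (Vj : GaugeField P j G) (p' : Plaq P j)
    (act : Plaq P 0 → ℝ) (hact : ∀ q ∈ deltaT j p', dist1 (GaugeField.plaqHol U q) ^ 2 ≤ 2 * act q)
    {gj gk p b C₁ C₂ : ℝ} (hgj : 0 < gj) (hgk : gk ^ 2 = gj ^ 2 * (P.L : ℝ) ^ (k - j)) (hp : 0 ≤ p)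
    (hgp : gj * p ≤ 1)
    (h67 : GaugeField.plaqHol (Averaging.iter av j U) p' = GaugeField.plaqHol Vj p')
    (hLF : gj * p ≤ dist1 (GaugeField.plaqHol Vj p'))
    (h68 : ∀ q ∈ deltaT j p', dist1 (GaugeField.plaqHol U q) ≤ C₁ * (gj * p) / ((P.L : ℝ) ^ j) ^ 2)
    (h69 : dist1 (GaugeField.plaqHol (Averaging.iter av j U) p') ≤
      blockSumT j p' (fun q => dist1 (GaugeField.plaqHol U q)) + b)
    (hb : 0 ≤ b) (hbB : b ≤ C₂ * (gj * p) ^ 2)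
    (hsmall : (2 * C₁ * C₂ + C₂ ^ 2) / 2 * gj * p ≤ 1 / 4) :
    p ^ 2 / 4 ≤ (gk ^ 2)⁻¹ * ((P.L : ℝ) ^ k * ∑ q ∈ deltaT j p', act q) := by
  set v : ℝ := dist1 (GaugeField.plaqHol Vj p') with hv
  have hv0 : 0 ≤ v := GaugeGroup.dist1_nonneg _
  have h69' : v ≤ blockSumT j p' (fun q => dist1 (GaugeField.plaqHol U q)) + b := by rw [hv, ← h67]; exact h69
  have h68' : ∀ t : Idx P.d (P.L ^ j),
      dist1 (GaugeField.plaqHol U (plaqAt p' (corner (P.L ^ j) (0 : LSite P.d) p'.μ p'.ν t))) ≤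
        C₁ * (gj * p) / ((P.L : ℝ) ^ j) ^ 2 :=
    fun t => h68 _ (plaqAt_corner_mem_deltaT hj p' t)
  have h70 := sq_le_of_le69_torus_d3 hd hj p' (F := fun q => dist1 (GaugeField.plaqHol U q)) (act := act)
    (fun q => GaugeGroup.dist1_nonneg _) hact hv0 h69' hb hbB (A := C₁ * (gj * p)) h68'
  -- the cross terms: 2AB + B² ≤ (2C₁C₂ + C₂²)(g_j p)³ for g_j p ≤ 1
  have hC2 : 0 ≤ C₂ * (gj * p) ^ 2 := hb.trans hbB
  have hε0 : 0 ≤ gj * p := by positivity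
  have hcross : 2 * (C₁ * (gj * p)) * (C₂ * (gj * p) ^ 2) + (C₂ * (gj * p) ^ 2) ^ 2 ≤
      (2 * C₁ * C₂ + C₂ ^ 2) * (gj * p) ^ 3 := by
    have h4 : (gj * p) ^ 4 ≤ (gj * p) ^ 3 := by
      calc (gj * p) ^ 4 = (gj * p) ^ 3 * (gj * p) := by ring
        _ ≤ (gj * p) ^ 3 * 1 := mul_le_mul_of_nonneg_left hgp (by positivity)
        _ = (gj * p) ^ 3 := by ring
    have hC22 : 0 ≤ C₂ ^ 2 := sq_nonneg _
    nlinarith [mul_le_mul_of_nonneg_left h4 hC22]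
  have hsum0 : 0 ≤ ∑ q ∈ deltaT j p', act q :=
    Finset.sum_nonneg fun q hq => by nlinarith [hact q hq, sq_nonneg (dist1 (GaugeField.plaqHol U q))]
  have h70' : v ^ 2 ≤ 2 * (P.L : ℝ) ^ j * (∑ q ∈ deltaT j p', act q) + (2 * C₁ * C₂ + C₂ ^ 2) * (gj * p) ^ 3 := by
    nlinarith
  have hLpos : (0 : ℝ) < P.L := by exact_mod_cast P.L_pos
  exact ineq71 hLpos hjk hgj hgk hp hLF h70' hsmall

/-- **The small factor** («the corresponding part of the exponential gives the small factor exp(−1/4p²(g_j))»): under the hypotheses of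
`smallFactor_of_largeField_torus`, `exp[−(1/g_k²)·η⁻¹·Σ_{q∈Δ′(p′)} act(q)] ≤ exp(−¼p²(g_j))`. [cite: Balaban1985UV3, (71) p.273] -/
theorem exp_localized_le_torus (hd : P.d = 3) (hj : j ≤ P.m + P.K) {k : ℕ} (hjk : j ≤ k)
    (av : ∀ i, Averaging P i G) (U : GaugeField P 0 G) (Vj : GaugeField P j G) (p' : Plaq P j)
    (act : Plaq P 0 → ℝ) (hact : ∀ q ∈ deltaT j p', dist1 (GaugeField.plaqHol U q) ^ 2 ≤ 2 * act q)
    {gj gk p b C₁ C₂ : ℝ} (hgj : 0 < gj) (hgk : gk ^ 2 = gj ^ 2 * (P.L : ℝ) ^ (k - j)) (hp : 0 ≤ p)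
    (hgp : gj * p ≤ 1)
    (h67 : GaugeField.plaqHol (Averaging.iter av j U) p' = GaugeField.plaqHol Vj p')
    (hLF : gj * p ≤ dist1 (GaugeField.plaqHol Vj p'))
    (h68 : ∀ q ∈ deltaT j p', dist1 (GaugeField.plaqHol U q) ≤ C₁ * (gj * p) / ((P.L : ℝ) ^ j) ^ 2)
    (h69 : dist1 (GaugeField.plaqHol (Averaging.iter av j U) p') ≤
      blockSumT j p' (fun q => dist1 (GaugeField.plaqHol U q)) + b)
    (hb : 0 ≤ b) (hbB : b ≤ C₂ * (gj * p) ^ 2)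
    (hsmall : (2 * C₁ * C₂ + C₂ ^ 2) / 2 * gj * p ≤ 1 / 4) :
    Real.exp (-((gk ^ 2)⁻¹ * ((P.L : ℝ) ^ k * ∑ q ∈ deltaT j p', act q))) ≤ Real.exp (-(p ^ 2 / 4)) := by
  have h := smallFactor_of_largeField_torus hd hj hjk av U Vj p' act hact hgj hgk hp hgp h67 hLF h68 h69 hb hbB hsmall
  exact Real.exp_le_exp.mpr (by linarith)

end Squaring

/-! ## §5 The hypothesis (11) `|U(∂q) − 1|² ≤ 2·act(q)` for the cell's `U(N)` -/

section Unitary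

open scoped Matrix.Norms.L2Operator

variable {N : ℕ} [NeZero N]

/-- **(11) p. 258 in the cell's letters for `G = U(N)`** (`UnitaryModel.instGaugeGroupUnitaryGroup`: `dist1 W = ‖W − 1‖_op`, `reTr W = Re Tr W / N`):
`dist1 W² ≤ 2·N(1 − reTr W)` — `B10Eq11Trace.eq11_opNorm` BY NAME; so the action density of §4 is `act(q) = N(1 − Re tr U(∂q))` (the
dimension factor of cell DIVERGENCE D-b10.1). [cite: Balaban1985UV3, (11) p.258] -/
theorem dist1_sq_le_unitaryGroup (W : Matrix.unitaryGroup (Fin N) ℂ) :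
    dist1 W ^ 2 ≤ 2 * ((N : ℝ) * (1 - reTr W)) := by
  have h := B10Eq11Trace.eq11_opNorm (W : Matrix (Fin N) (Fin N) ℂ) W.2
  rw [Fintype.card_fin] at h
  have e1 : dist1 W = ‖(W : Matrix (Fin N) (Fin N) ℂ) - 1‖ := rfl
  have e2 : reTr W = ((W : Matrix (Fin N) (Fin N) ℂ).trace.re) / (Fintype.card (Fin N) : ℝ) := rfl
  rw [Fintype.card_fin] at e2
  have hN : (N : ℝ) ≠ 0 := by exact_mod_cast NeZero.ne N
  rw [e1, e2]
  have e3 : 2 * ((N : ℝ) * (1 - (W : Matrix (Fin N) (Fin N) ℂ).trace.re / (N : ℝ))) =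
      2 * (N : ℝ) * (1 - (N : ℝ)⁻¹ * (W : Matrix (Fin N) (Fin N) ℂ).trace.re) := by
    field_simp
  rw [e3]
  exact h

/-- **(67)–(71) FOR ONE LARGE-FIELD PLAQUETTE ON THE TORUS, `G = U(N)`**: the conclusion of `smallFactor_of_largeField_torus` with the action
density SUPPLIED by (11), `¼p²(g_j) ≤ (N/g_k²)·L^k·Σ_{q∈Δ′(p′)}[1 − Re tr U_k(∂q)]`. [cite: Balaban1985UV3, (67)–(71) p.273, (11) p.258] -/
theorem smallFactor_of_largeField_torus_unitaryGroup (hd : P.d = 3) {j : ℕ} (hj : j ≤ P.m + P.K) {k : ℕ} (hjk : j ≤ k)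
    (av : ∀ i, Averaging P i (Matrix.unitaryGroup (Fin N) ℂ)) (U : GaugeField P 0 (Matrix.unitaryGroup (Fin N) ℂ))
    (Vj : GaugeField P j (Matrix.unitaryGroup (Fin N) ℂ)) (p' : Plaq P j)
    {gj gk p b C₁ C₂ : ℝ} (hgj : 0 < gj) (hgk : gk ^ 2 = gj ^ 2 * (P.L : ℝ) ^ (k - j)) (hp : 0 ≤ p)
    (hgp : gj * p ≤ 1)
    (h67 : GaugeField.plaqHol (Averaging.iter av j U) p' = GaugeField.plaqHol Vj p')
    (hLF : gj * p ≤ dist1 (GaugeField.plaqHol Vj p'))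
    (h68 : ∀ q ∈ deltaT j p', dist1 (GaugeField.plaqHol U q) ≤ C₁ * (gj * p) / ((P.L : ℝ) ^ j) ^ 2)
    (h69 : dist1 (GaugeField.plaqHol (Averaging.iter av j U) p') ≤
      blockSumT j p' (fun q => dist1 (GaugeField.plaqHol U q)) + b)
    (hb : 0 ≤ b) (hbB : b ≤ C₂ * (gj * p) ^ 2)
    (hsmall : (2 * C₁ * C₂ + C₂ ^ 2) / 2 * gj * p ≤ 1 / 4) :
    p ^ 2 / 4 ≤ (gk ^ 2)⁻¹ * ((P.L : ℝ) ^ k *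
      ∑ q ∈ deltaT j p', (N : ℝ) * (1 - reTr (GaugeField.plaqHol U q))) :=
  smallFactor_of_largeField_torus hd hj hjk av U Vj p' (fun q => (N : ℝ) * (1 - reTr (GaugeField.plaqHol U q)))
    (fun _ _ => dist1_sq_le_unitaryGroup _) hgj hgk hp hgp h67 hLF h68 h69 hb hbB hsmall

end Unitary

/-! ## §5b The same for the cell's `SU(N)` — the semi-simple group of Theorem 1 (p. 257 «with a semi-simple compact group Lie G») -/

section SpecialUnitary

open scoped Matrix.Norms.L2Operator
open Literature.MathematicalPhysics.QuantumLattice (fundamentalRep fundamentalRep_mem_unitaryGroup)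

variable {N : ℕ} [NeZero N]

/-- **(11) p. 258 in the cell's letters for `G = SU(N)`** (`UnitaryModel.instGaugeGroupSpecialUnitaryGroup`, through the fundamental representation):
`dist1 W² ≤ 2·N(1 − reTr W)`. [cite: Balaban1985UV3, (11) p.258] -/
theorem dist1_sq_le_specialUnitaryGroup (W : Matrix.specialUnitaryGroup (Fin N) ℂ) :
    dist1 W ^ 2 ≤ 2 * ((N : ℝ) * (1 - reTr W)) := by
  have h := B10Eq11Trace.eq11_opNorm (fundamentalRep (Fin N) W) (fundamentalRep_mem_unitaryGroup W)
  rw [Fintype.card_fin] at h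
  have e1 : dist1 W = ‖fundamentalRep (Fin N) W - 1‖ := rfl
  have e2 : reTr W = ((fundamentalRep (Fin N) W).trace.re) / (Fintype.card (Fin N) : ℝ) := rfl
  rw [Fintype.card_fin] at e2
  have hN : (N : ℝ) ≠ 0 := by exact_mod_cast NeZero.ne N
  rw [e1, e2]
  have e3 : 2 * ((N : ℝ) * (1 - (fundamentalRep (Fin N) W).trace.re / (N : ℝ))) =
      2 * (N : ℝ) * (1 - (N : ℝ)⁻¹ * (fundamentalRep (Fin N) W).trace.re) := by
    field_simp
  rw [e3]
  exact h

/-- **(67)–(71) FOR ONE LARGE-FIELD PLAQUETTE ON THE TORUS, `G = SU(N)`**: `¼p²(g_j) ≤ (N/g_k²)·L^k·Σ_{q∈Δ′(p′)}[1 − Re tr U_k(∂q)]`.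
[cite: Balaban1985UV3, (67)–(71) p.273, (11) p.258] -/
theorem smallFactor_of_largeField_torus_specialUnitaryGroup (hd : P.d = 3) {j : ℕ} (hj : j ≤ P.m + P.K) {k : ℕ}
    (hjk : j ≤ k) (av : ∀ i, Averaging P i (Matrix.specialUnitaryGroup (Fin N) ℂ))
    (U : GaugeField P 0 (Matrix.specialUnitaryGroup (Fin N) ℂ)) (Vj : GaugeField P j (Matrix.specialUnitaryGroup (Fin N) ℂ))
    (p' : Plaq P j) {gj gk p b C₁ C₂ : ℝ} (hgj : 0 < gj) (hgk : gk ^ 2 = gj ^ 2 * (P.L : ℝ) ^ (k - j)) (hp : 0 ≤ p)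
    (hgp : gj * p ≤ 1)
    (h67 : GaugeField.plaqHol (Averaging.iter av j U) p' = GaugeField.plaqHol Vj p')
    (hLF : gj * p ≤ dist1 (GaugeField.plaqHol Vj p'))
    (h68 : ∀ q ∈ deltaT j p', dist1 (GaugeField.plaqHol U q) ≤ C₁ * (gj * p) / ((P.L : ℝ) ^ j) ^ 2)
    (h69 : dist1 (GaugeField.plaqHol (Averaging.iter av j U) p') ≤
      blockSumT j p' (fun q => dist1 (GaugeField.plaqHol U q)) + b)
    (hb : 0 ≤ b) (hbB : b ≤ C₂ * (gj * p) ^ 2)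
    (hsmall : (2 * C₁ * C₂ + C₂ ^ 2) / 2 * gj * p ≤ 1 / 4) :
    p ^ 2 / 4 ≤ (gk ^ 2)⁻¹ * ((P.L : ℝ) ^ k *
      ∑ q ∈ deltaT j p', (N : ℝ) * (1 - reTr (GaugeField.plaqHol U q))) :=
  smallFactor_of_largeField_torus hd hj hjk av U Vj p' (fun q => (N : ℝ) * (1 - reTr (GaugeField.plaqHol U q)))
    (fun _ _ => dist1_sq_le_specialUnitaryGroup _) hgj hgk hp hgp h67 hLF h68 h69 hb hbB hsmall

end SpecialUnitary

/-! ## §6 The knit: «We get these small factors for all plaquettes in all large fields set P» on the torus, from the per-plaquette (67)–(69) -/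

section AllPlaquettes

open B10Eq38TorusDomains (plaqsIn)

variable {G : Type*} [GaugeGroup G]
variable (M₁ : ℕ) (R : ℕ → ℝ) (Ω₀ : Set (Site P 0)) (S : (j : ℕ) → Finset (Plaq P j))

/-- **THE SMALL FACTORS FOR ALL LARGE-FIELD PLAQUETTES OF ALL SCALES, ON THE TORUS CARRIER OF RECORD, FROM THE PRINTED PER-PLAQUETTE INPUTS**
(`d = 3`): in the setting of `B10Eq71TorusOverlap.quarter_sum_le_of_local71_torus` (the domains `Ω_j` generated by the p. 268 rule from the
large-field plaquette sets `P_j = S j ⊆ plaqsIn j Ω_j`, `R(g_i)M₁ ≥ 0`, `L ∣ M₁`, levels `j ∈ J` with `j ≤ m + K` and `j ≤ k`, the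
history's plaquettes `S′ j ⊆ S j`, a finite set `Y` of fine plaquettes containing every `Δ′_j(p′)` with (11) `|U_k(∂q) − 1|² ≤ 2·act(q)`
on `Y`), suppose FOR EVERY `j ∈ J` AND `p′ ∈ S′ j` the printed data of Sect. D: (67) `Ū_k^j(∂p′) = V_j(∂p′)`, the large-field condition
`g_jp(g_j) ≤ |V_j(∂p′) − 1|`, (68) on `Δ′_j(p′)`, (69) with remainder `b(j, p′) ≤ C₂(g_jp(g_j))²`, the progression `g_k² = g_j²L^{k−j}`,
`g_jp(g_j) ≤ 1` and «g_j sufficiently small».  THEN the hypothesis `h71` of `B10Eq71TorusOverlap` is DISCHARGED and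
**`¼·Σ_{j∈J} Σ_{p′∈S′ j} ¼p²(g_j) ≤ (1/g_k²)·η⁻¹·Σ_{q∈Y} act(q)`** — `B10LargeFieldSum.SmallFactorsAll`'s inequality with `c₁ = ¼`, END TO
END on the torus modulo the per-plaquette printed inputs (67)–(69). [cite: Balaban1985UV3, (67)–(71) p.273, (41) p.266, (38) p.266, p.268] -/
theorem quarter_sum_le_of_printed_torus (hd : P.d = 3) (hR : ∀ i, 0 ≤ R i * M₁) (hdiv : P.L ∣ M₁) (J : Finset ℕ)
    (hJ : ∀ j ∈ J, j ≤ P.m + P.K) {k : ℕ} (hJk : ∀ j ∈ J, j ≤ k) (S' : (j : ℕ) → Finset (Plaq P j))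
    (hS' : ∀ j ∈ J, S' j ⊆ S j)
    (hS : ∀ j ∈ J, S j ⊆ plaqsIn j (B10Eq71TorusOverlap.Ω M₁ R Ω₀ S j)) (Y : Finset (Plaq P 0))
    (hY : ∀ j ∈ J, ∀ p' ∈ S' j, deltaT j p' ⊆ Y)
    (av : ∀ i, Averaging P i G) (U : GaugeField P 0 G) (V : (j : ℕ) → GaugeField P j G)
    (act : Plaq P 0 → ℝ) (hact : ∀ q ∈ Y, dist1 (GaugeField.plaqHol U q) ^ 2 ≤ 2 * act q)
    (g : ℕ → ℝ) (pj : ℕ → ℝ) (bj : (j : ℕ) → Plaq P j → ℝ) {gk C₁ C₂ : ℝ}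
    (hgj : ∀ j ∈ J, 0 < g j) (hgk : ∀ j ∈ J, gk ^ 2 = g j ^ 2 * (P.L : ℝ) ^ (k - j)) (hp : ∀ j ∈ J, 0 ≤ pj j)
    (hgp : ∀ j ∈ J, g j * pj j ≤ 1)
    (h67 : ∀ j ∈ J, ∀ p' ∈ S' j, GaugeField.plaqHol (Averaging.iter av j U) p' = GaugeField.plaqHol (V j) p')
    (hLF : ∀ j ∈ J, ∀ p' ∈ S' j, g j * pj j ≤ dist1 (GaugeField.plaqHol (V j) p'))
    (h68 : ∀ j ∈ J, ∀ p' ∈ S' j, ∀ q ∈ deltaT j p',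
      dist1 (GaugeField.plaqHol U q) ≤ C₁ * (g j * pj j) / ((P.L : ℝ) ^ j) ^ 2)
    (h69 : ∀ j ∈ J, ∀ p' ∈ S' j, dist1 (GaugeField.plaqHol (Averaging.iter av j U) p') ≤
      blockSumT j p' (fun q => dist1 (GaugeField.plaqHol U q)) + bj j p')
    (hb : ∀ j ∈ J, ∀ p' ∈ S' j, 0 ≤ bj j p') (hbB : ∀ j ∈ J, ∀ p' ∈ S' j, bj j p' ≤ C₂ * (g j * pj j) ^ 2)
    (hsmall : ∀ j ∈ J, (2 * C₁ * C₂ + C₂ ^ 2) / 2 * g j * pj j ≤ 1 / 4) :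
    (1 / 4 : ℝ) * ∑ j ∈ J, ∑ _p' ∈ S' j, pj j ^ 2 / 4 ≤ ((gk ^ 2)⁻¹ * (P.L : ℝ) ^ k) * ∑ q ∈ Y, act q := by
  have hact0 : ∀ q ∈ Y, 0 ≤ act q := fun q hq => by nlinarith [hact q hq, sq_nonneg (dist1 (GaugeField.plaqHol U q))]
  have hc : 0 ≤ (gk ^ 2)⁻¹ * (P.L : ℝ) ^ k := by positivity
  refine B10Eq71TorusOverlap.quarter_sum_le_of_local71_torus M₁ R Ω₀ S hR hdiv J hJ S' hS' hS Y hY act hact0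
    (fun j _ => pj j ^ 2 / 4) hc ?_
  intro j hj p' hp'
  have hactj : ∀ q ∈ deltaT j p', dist1 (GaugeField.plaqHol U q) ^ 2 ≤ 2 * act q :=
    fun q hq => hact q (hY j hj p' hp' hq)
  have h := smallFactor_of_largeField_torus hd (hJ j hj) (hJk j hj) av U (V j) p' act hactj (hgj j hj) (hgk j hj)
    (hp j hj) (hgp j hj) (h67 j hj p' hp') (hLF j hj p' hp') (h68 j hj p' hp') (h69 j hj p' hp') (hb j hj p' hp')
    (hbB j hj p' hp') (hsmall j hj)
  rw [mul_assoc]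
  exact h

/-- The same with the printed weights `p(g_j) = b₀(1 + log g_j⁻¹)^{p₀}` (`B10.pFun`) along the coupling progression: literally the hypothesis-free
form of `B10Eq71TorusOverlap.smallFactorsAll_shape_torus` — `¼·Σ_{j∈J} Σ_{p′∈S′ j} ¼p(g_j)² ≤ (1/g_k²)·L^k·Σ_{q∈Y} act(q)`.
[cite: Balaban1985UV3, (71) p.273, (41) p.266, (7) p.257] -/
theorem smallFactorsAll_of_printed_torus (hd : P.d = 3) (hR : ∀ i, 0 ≤ R i * M₁) (hdiv : P.L ∣ M₁) (J : Finset ℕ)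
    (hJ : ∀ j ∈ J, j ≤ P.m + P.K) {k : ℕ} (hJk : ∀ j ∈ J, j ≤ k) (S' : (j : ℕ) → Finset (Plaq P j))
    (hS' : ∀ j ∈ J, S' j ⊆ S j)
    (hS : ∀ j ∈ J, S j ⊆ plaqsIn j (B10Eq71TorusOverlap.Ω M₁ R Ω₀ S j)) (Y : Finset (Plaq P 0))
    (hY : ∀ j ∈ J, ∀ p' ∈ S' j, deltaT j p' ⊆ Y)
    (av : ∀ i, Averaging P i G) (U : GaugeField P 0 G) (V : (j : ℕ) → GaugeField P j G)
    (act : Plaq P 0 → ℝ) (hact : ∀ q ∈ Y, dist1 (GaugeField.plaqHol U q) ^ 2 ≤ 2 * act q)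
    (g : ℕ → ℝ) (b₀ p₀ : ℝ) (bj : (j : ℕ) → Plaq P j → ℝ) {gk C₁ C₂ : ℝ}
    (hgj : ∀ j ∈ J, 0 < g j) (hgk : ∀ j ∈ J, gk ^ 2 = g j ^ 2 * (P.L : ℝ) ^ (k - j))
    (hp : ∀ j ∈ J, 0 ≤ B10.pFun b₀ p₀ (g j)) (hgp : ∀ j ∈ J, g j * B10.pFun b₀ p₀ (g j) ≤ 1)
    (h67 : ∀ j ∈ J, ∀ p' ∈ S' j, GaugeField.plaqHol (Averaging.iter av j U) p' = GaugeField.plaqHol (V j) p')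
    (hLF : ∀ j ∈ J, ∀ p' ∈ S' j, g j * B10.pFun b₀ p₀ (g j) ≤ dist1 (GaugeField.plaqHol (V j) p'))
    (h68 : ∀ j ∈ J, ∀ p' ∈ S' j, ∀ q ∈ deltaT j p',
      dist1 (GaugeField.plaqHol U q) ≤ C₁ * (g j * B10.pFun b₀ p₀ (g j)) / ((P.L : ℝ) ^ j) ^ 2)
    (h69 : ∀ j ∈ J, ∀ p' ∈ S' j, dist1 (GaugeField.plaqHol (Averaging.iter av j U) p') ≤
      blockSumT j p' (fun q => dist1 (GaugeField.plaqHol U q)) + bj j p')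
    (hb : ∀ j ∈ J, ∀ p' ∈ S' j, 0 ≤ bj j p')
    (hbB : ∀ j ∈ J, ∀ p' ∈ S' j, bj j p' ≤ C₂ * (g j * B10.pFun b₀ p₀ (g j)) ^ 2)
    (hsmall : ∀ j ∈ J, (2 * C₁ * C₂ + C₂ ^ 2) / 2 * g j * B10.pFun b₀ p₀ (g j) ≤ 1 / 4) :
    (1 / 4 : ℝ) * ∑ j ∈ J, ∑ _p' ∈ S' j, B10.pFun b₀ p₀ (g j) ^ 2 / 4 ≤
      ((gk ^ 2)⁻¹ * (P.L : ℝ) ^ k) * ∑ q ∈ Y, act q :=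
  quarter_sum_le_of_printed_torus M₁ R Ω₀ S hd hR hdiv J hJ hJk S' hS' hS Y hY av U V act hact g
    (fun j => B10.pFun b₀ p₀ (g j)) bj hgj hgk hp hgp h67 hLF h68 h69 hb hbB hsmall

end AllPlaquettes

/-! ## §7 In the cell's letters for `U(N)` / `SU(N)`: the whole action `(1/g_k²)A^η(U_k)` (`Setup.wilsonAction`) dominates the small-factor exponents -/

section WilsonAction

open B10Eq38TorusDomains (plaqsIn)

variable (M₁ : ℕ) (R : ℕ → ℝ) (Ω₀ : Set (Site P 0)) (S : (j : ℕ) → Finset (Plaq P j))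
variable {N : ℕ} [NeZero N]

/-- **«We get these small factors for all plaquettes in all large fields set P» AGAINST THE FULL ACTION, `G = U(N)`, `d = 3`:** with `Y` = all
fine plaquettes and (11) supplied by `dist1_sq_le_unitaryGroup`, the knit `quarter_sum_le_of_printed_torus` reads
**`¼·Σ_{j∈J} Σ_{p′∈S′ j} ¼p_j² ≤ (N/g_k²)·A^η(U_k)`** where `A^η` is the action of p. 256 (the display after (5): «A^η(U_k(U)) = Σ_{p⊂T_η}
η^{−1}[1 − Re tr U_k(U, ∂p)], η = L^{−k}»), i.e. the cell's `wilsonAction (L^k) U` (the weight `η^{d−4}` of [Balaban1987RG1] (0.2) in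
`Setup.wilsonAction` at `d = 3` is `η⁻¹ = L^k`) — the sum of the exponents of the small factors `exp(−¼p²(g_j))` of all large-field plaquettes
of all scales is dominated by `4N` times the action term `(1/g_k²)A^η(U_k)` of (41); hypotheses (67)–(69) per plaquette as in §6.
[cite: Balaban1985UV3, (71) p.273, (41) p.266, (5) p.256] -/
theorem quarter_sum_le_wilsonAction_unitaryGroup (hd : P.d = 3) (hR : ∀ i, 0 ≤ R i * M₁) (hdiv : P.L ∣ M₁) (J : Finset ℕ)
    (hJ : ∀ j ∈ J, j ≤ P.m + P.K) {k : ℕ} (hJk : ∀ j ∈ J, j ≤ k) (S' : (j : ℕ) → Finset (Plaq P j))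
    (hS' : ∀ j ∈ J, S' j ⊆ S j)
    (hS : ∀ j ∈ J, S j ⊆ plaqsIn j (B10Eq71TorusOverlap.Ω M₁ R Ω₀ S j))
    (av : ∀ i, Averaging P i (Matrix.unitaryGroup (Fin N) ℂ)) (U : GaugeField P 0 (Matrix.unitaryGroup (Fin N) ℂ))
    (V : (j : ℕ) → GaugeField P j (Matrix.unitaryGroup (Fin N) ℂ))
    (g : ℕ → ℝ) (pj : ℕ → ℝ) (bj : (j : ℕ) → Plaq P j → ℝ) {gk C₁ C₂ : ℝ}
    (hgj : ∀ j ∈ J, 0 < g j) (hgk : ∀ j ∈ J, gk ^ 2 = g j ^ 2 * (P.L : ℝ) ^ (k - j)) (hp : ∀ j ∈ J, 0 ≤ pj j)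
    (hgp : ∀ j ∈ J, g j * pj j ≤ 1)
    (h67 : ∀ j ∈ J, ∀ p' ∈ S' j, GaugeField.plaqHol (Averaging.iter av j U) p' = GaugeField.plaqHol (V j) p')
    (hLF : ∀ j ∈ J, ∀ p' ∈ S' j, g j * pj j ≤ dist1 (GaugeField.plaqHol (V j) p'))
    (h68 : ∀ j ∈ J, ∀ p' ∈ S' j, ∀ q ∈ deltaT j p',
      dist1 (GaugeField.plaqHol U q) ≤ C₁ * (g j * pj j) / ((P.L : ℝ) ^ j) ^ 2)
    (h69 : ∀ j ∈ J, ∀ p' ∈ S' j, dist1 (GaugeField.plaqHol (Averaging.iter av j U) p') ≤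
      blockSumT j p' (fun q => dist1 (GaugeField.plaqHol U q)) + bj j p')
    (hb : ∀ j ∈ J, ∀ p' ∈ S' j, 0 ≤ bj j p') (hbB : ∀ j ∈ J, ∀ p' ∈ S' j, bj j p' ≤ C₂ * (g j * pj j) ^ 2)
    (hsmall : ∀ j ∈ J, (2 * C₁ * C₂ + C₂ ^ 2) / 2 * g j * pj j ≤ 1 / 4) :
    (1 / 4 : ℝ) * ∑ j ∈ J, ∑ _p' ∈ S' j, pj j ^ 2 / 4 ≤
      ((gk ^ 2)⁻¹ * (N : ℝ)) * wilsonAction ((P.L : ℝ) ^ k) U := by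
  have h := quarter_sum_le_of_printed_torus M₁ R Ω₀ S hd hR hdiv J hJ hJk S' hS' hS Finset.univ
    (fun _ _ _ _ => Finset.subset_univ _) av U V (fun q => (N : ℝ) * (1 - reTr (GaugeField.plaqHol U q)))
    (fun _ _ => dist1_sq_le_unitaryGroup _) g pj bj hgj hgk hp hgp h67 hLF h68 h69 hb hbB hsmall
  have e : ((gk ^ 2)⁻¹ * (P.L : ℝ) ^ k) * ∑ q : Plaq P 0, (N : ℝ) * (1 - reTr (GaugeField.plaqHol U q)) =
      ((gk ^ 2)⁻¹ * (N : ℝ)) * wilsonAction ((P.L : ℝ) ^ k) U := by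
    unfold wilsonAction
    rw [Finset.mul_sum, Finset.mul_sum]
    refine Finset.sum_congr rfl fun q _ => ?_
    ring
  rw [← e]
  exact h

/-- The same for the semi-simple group `G = SU(N)` of Theorem 1. [cite: Balaban1985UV3, (71) p.273, (41) p.266, (5) p.256] -/
theorem quarter_sum_le_wilsonAction_specialUnitaryGroup (hd : P.d = 3) (hR : ∀ i, 0 ≤ R i * M₁) (hdiv : P.L ∣ M₁)
    (J : Finset ℕ) (hJ : ∀ j ∈ J, j ≤ P.m + P.K) {k : ℕ} (hJk : ∀ j ∈ J, j ≤ k) (S' : (j : ℕ) → Finset (Plaq P j))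
    (hS' : ∀ j ∈ J, S' j ⊆ S j)
    (hS : ∀ j ∈ J, S j ⊆ plaqsIn j (B10Eq71TorusOverlap.Ω M₁ R Ω₀ S j))
    (av : ∀ i, Averaging P i (Matrix.specialUnitaryGroup (Fin N) ℂ))
    (U : GaugeField P 0 (Matrix.specialUnitaryGroup (Fin N) ℂ))
    (V : (j : ℕ) → GaugeField P j (Matrix.specialUnitaryGroup (Fin N) ℂ))
    (g : ℕ → ℝ) (pj : ℕ → ℝ) (bj : (j : ℕ) → Plaq P j → ℝ) {gk C₁ C₂ : ℝ}
    (hgj : ∀ j ∈ J, 0 < g j) (hgk : ∀ j ∈ J, gk ^ 2 = g j ^ 2 * (P.L : ℝ) ^ (k - j)) (hp : ∀ j ∈ J, 0 ≤ pj j)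
    (hgp : ∀ j ∈ J, g j * pj j ≤ 1)
    (h67 : ∀ j ∈ J, ∀ p' ∈ S' j, GaugeField.plaqHol (Averaging.iter av j U) p' = GaugeField.plaqHol (V j) p')
    (hLF : ∀ j ∈ J, ∀ p' ∈ S' j, g j * pj j ≤ dist1 (GaugeField.plaqHol (V j) p'))
    (h68 : ∀ j ∈ J, ∀ p' ∈ S' j, ∀ q ∈ deltaT j p',
      dist1 (GaugeField.plaqHol U q) ≤ C₁ * (g j * pj j) / ((P.L : ℝ) ^ j) ^ 2)
    (h69 : ∀ j ∈ J, ∀ p' ∈ S' j, dist1 (GaugeField.plaqHol (Averaging.iter av j U) p') ≤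
      blockSumT j p' (fun q => dist1 (GaugeField.plaqHol U q)) + bj j p')
    (hb : ∀ j ∈ J, ∀ p' ∈ S' j, 0 ≤ bj j p') (hbB : ∀ j ∈ J, ∀ p' ∈ S' j, bj j p' ≤ C₂ * (g j * pj j) ^ 2)
    (hsmall : ∀ j ∈ J, (2 * C₁ * C₂ + C₂ ^ 2) / 2 * g j * pj j ≤ 1 / 4) :
    (1 / 4 : ℝ) * ∑ j ∈ J, ∑ _p' ∈ S' j, pj j ^ 2 / 4 ≤
      ((gk ^ 2)⁻¹ * (N : ℝ)) * wilsonAction ((P.L : ℝ) ^ k) U := by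
  have h := quarter_sum_le_of_printed_torus M₁ R Ω₀ S hd hR hdiv J hJ hJk S' hS' hS Finset.univ
    (fun _ _ _ _ => Finset.subset_univ _) av U V (fun q => (N : ℝ) * (1 - reTr (GaugeField.plaqHol U q)))
    (fun _ _ => dist1_sq_le_specialUnitaryGroup _) g pj bj hgj hgk hp hgp h67 hLF h68 h69 hb hbB hsmall
  have e : ((gk ^ 2)⁻¹ * (P.L : ℝ) ^ k) * ∑ q : Plaq P 0, (N : ℝ) * (1 - reTr (GaugeField.plaqHol U q)) =
      ((gk ^ 2)⁻¹ * (N : ℝ)) * wilsonAction ((P.L : ℝ) ^ k) U := by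
    unfold wilsonAction
    rw [Finset.mul_sum, Finset.mul_sum]
    refine Finset.sum_congr rfl fun q _ => ?_
    ring
  rw [← e]
  exact h

end WilsonAction


end Literature.MathematicalPhysics.QuantumFieldTheory.Balaban1983to89.B10Eq71TorusLocal

end
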